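import Literature.Geometry.DiscreteGeometry.SphericalCodeHullVertexAngles
import Literature.Geometry.DiscreteGeometry.PolygonalConeFanAngles
import HarnessLib

/-!
# The angles of the fan triangles around a vertex of the hull of a spherical code sum to `2π`

Topic `Literature/Geometry/DiscreteGeometry`.  Assembly of `SphericalCodeHullVertexAngles.lean`
(the intrinsic facet angles `facetAngleAt X c y` at a point `y ∈ X` sum to `2π` over the facets
containing `y`, and equal the dihedral angles `polyDih` of the facet polygons) with
`PolygonalConeFanAngles.lean` (the dihedral angles of a convex polygonal cone are sums of the
angles of its fan triangles `(w 0, w (i+1), w (i+2))`): the facet angle at the `j`-th vertex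
`w j` of a facet (`w = facetVertex X c _`, `m` vertices) is

* `facetAngleAt_vertex_zero` (`j = 0`): `Σ_{i < m−2} ∠(perpTo (w 0) (w (i+1)), perpTo (w 0) (w (i+2)))`;
* `facetAngleAt_vertex_one` (`j = 1`): `∠(perpTo (w 1) (w 0), perpTo (w 1) (w 2))`;
* `facetAngleAt_vertex_mid` (`2 ≤ j ≤ m − 2`):
  `∠(perpTo (w j) (w 0), perpTo (w j) (w (j−1))) + ∠(perpTo (w j) (w 0), perpTo (w j) (w (j+1)))`;
* `facetAngleAt_vertex_last` (`j = m − 1`): `∠(perpTo (w (m−1)) (w 0), perpTo (w (m−1)) (w (m−2)))`,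

each summand being the angle at `w j` of a fan triangle of the facet, in the argument order of
`sphExcess` (`SphericalExcessEuler.lean`: `sphExcess a b c = ∠ₐ + ∠_b + ∠_c − π` with
`∠ₐ = ∠(perpTo a b, perpTo a c)`, `∠_b = ∠(perpTo b a, perpTo b c)`,
`∠_c = ∠(perpTo c a, perpTo c b)`).  With `sum_facetAngleAt` these are the node equations
"the angles around each node sum to `2π`" (Hales, arXiv:1209.6043, proof of Lemma 9) for the
fan-refined Delaunay triangulation of a twelve-point kissing configuration — the interface of
the linear-programming exclusions.  Everything is PROVED; no named facts.

## References
* A.-M. Legendre, *Éléments de géométrie* (1794), VII.25. [folklore]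
* T. C. Hales, arXiv:1209.6043 (2012), proof of Lemma 9. [`Hales2012`]
-/

noncomputable section

namespace Literature.Geometry.DiscreteGeometry

open Real RealInnerProductSpace InnerProductGeometry Finset

local notation "E3" => EuclideanSpace ℝ (Fin 3)

section VertexFanAngles

variable {X : Finset E3}

/-- **Facet angle at the apex `w 0` of the fan = sum of the `m − 2` fan angles there.**
[folklore] -/
theorem facetAngleAt_vertex_zero (hX1 : ∀ y ∈ X, ‖y‖ = 1)
    (h0 : (0 : E3) ∈ interior (convexHull ℝ (X : Set E3))) {c : E3} (hc : c ∈ facetNormals X) :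
    facetAngleAt X c (facetVertex X c (ne_zero_of_mem_facetNormals hX1 hc) 0) =
      ∑ i ∈ range ((facetAngles X c (ne_zero_of_mem_facetNormals hX1 hc)).card - 2),
        angle
          (perpTo (facetVertex X c (ne_zero_of_mem_facetNormals hX1 hc) 0)
            (facetVertex X c (ne_zero_of_mem_facetNormals hX1 hc) (i + 1)))
          (perpTo (facetVertex X c (ne_zero_of_mem_facetNormals hX1 hc) 0)
            (facetVertex X c (ne_zero_of_mem_facetNormals hX1 hc) (i + 2))) := by
  have hm : 3 ≤ (facetAngles X c (ne_zero_of_mem_facetNormals hX1 hc)).card := by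
    rw [card_facetAngles hX1]; exact three_le_card_tightSet hc
  rw [facetAngleAt_eq_polyDih hX1 h0 hc (by omega)]
  exact polyDih_zero_eq_sum hm fun i j k hij hjk hk => orient3_facetVertex_pos hX1 hc hij hjk hk

/-- **Facet angle at `w 1` = the angle there of the first fan triangle `(w 0, w 1, w 2)`.**
[folklore] -/
theorem facetAngleAt_vertex_one (hX1 : ∀ y ∈ X, ‖y‖ = 1)
    (h0 : (0 : E3) ∈ interior (convexHull ℝ (X : Set E3))) {c : E3} (hc : c ∈ facetNormals X) :
    facetAngleAt X c (facetVertex X c (ne_zero_of_mem_facetNormals hX1 hc) 1) =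
      angle
        (perpTo (facetVertex X c (ne_zero_of_mem_facetNormals hX1 hc) 1)
          (facetVertex X c (ne_zero_of_mem_facetNormals hX1 hc) 0))
        (perpTo (facetVertex X c (ne_zero_of_mem_facetNormals hX1 hc) 1)
          (facetVertex X c (ne_zero_of_mem_facetNormals hX1 hc) 2)) := by
  have hm : 3 ≤ (facetAngles X c (ne_zero_of_mem_facetNormals hX1 hc)).card := by
    rw [card_facetAngles hX1]; exact three_le_card_tightSet hc
  rw [facetAngleAt_eq_polyDih hX1 h0 hc (by omega)]
  exact polyDih_one_eq hm

/-- **Facet angle at a middle vertex `w j` (`2 ≤ j ≤ m − 2`) = the two fan angles there**, of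
the fan triangles `(w 0, w (j−1), w j)` and `(w 0, w j, w (j+1))` (in the argument order of
`sphExcess`: the vertex first, then `w 0`). [folklore] -/
theorem facetAngleAt_vertex_mid (hX1 : ∀ y ∈ X, ‖y‖ = 1)
    (h0 : (0 : E3) ∈ interior (convexHull ℝ (X : Set E3))) {c : E3} (hc : c ∈ facetNormals X)
    {j : ℕ} (h2 : 2 ≤ j) (hj : j + 2 ≤ (facetAngles X c (ne_zero_of_mem_facetNormals hX1 hc)).card) :
    facetAngleAt X c (facetVertex X c (ne_zero_of_mem_facetNormals hX1 hc) j) =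
      angle
          (perpTo (facetVertex X c (ne_zero_of_mem_facetNormals hX1 hc) j)
            (facetVertex X c (ne_zero_of_mem_facetNormals hX1 hc) 0))
          (perpTo (facetVertex X c (ne_zero_of_mem_facetNormals hX1 hc) j)
            (facetVertex X c (ne_zero_of_mem_facetNormals hX1 hc) (j - 1))) +
        angle
          (perpTo (facetVertex X c (ne_zero_of_mem_facetNormals hX1 hc) j)
            (facetVertex X c (ne_zero_of_mem_facetNormals hX1 hc) 0))
          (perpTo (facetVertex X c (ne_zero_of_mem_facetNormals hX1 hc) j)
            (facetVertex X c (ne_zero_of_mem_facetNormals hX1 hc) (j + 1))) := by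
  have hm : 3 ≤ (facetAngles X c (ne_zero_of_mem_facetNormals hX1 hc)).card := by
    rw [card_facetAngles hX1]; exact three_le_card_tightSet hc
  rw [facetAngleAt_eq_polyDih hX1 h0 hc (by omega),
    polyDih_eq_add hm (fun i j k hij hjk hk => orient3_facetVertex_pos hX1 hc hij hjk hk) h2 hj,
    angle_comm]

/-- **Facet angle at the last vertex `w (m−1)` = the angle there of the last fan triangle
`(w 0, w (m−2), w (m−1))`.** [folklore] -/
theorem facetAngleAt_vertex_last (hX1 : ∀ y ∈ X, ‖y‖ = 1)
    (h0 : (0 : E3) ∈ interior (convexHull ℝ (X : Set E3))) {c : E3} (hc : c ∈ facetNormals X) :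
    facetAngleAt X c (facetVertex X c (ne_zero_of_mem_facetNormals hX1 hc)
        ((facetAngles X c (ne_zero_of_mem_facetNormals hX1 hc)).card - 1)) =
      angle
        (perpTo (facetVertex X c (ne_zero_of_mem_facetNormals hX1 hc)
            ((facetAngles X c (ne_zero_of_mem_facetNormals hX1 hc)).card - 1))
          (facetVertex X c (ne_zero_of_mem_facetNormals hX1 hc) 0))
        (perpTo (facetVertex X c (ne_zero_of_mem_facetNormals hX1 hc)
            ((facetAngles X c (ne_zero_of_mem_facetNormals hX1 hc)).card - 1))
          (facetVertex X c (ne_zero_of_mem_facetNormals hX1 hc)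
            ((facetAngles X c (ne_zero_of_mem_facetNormals hX1 hc)).card - 2))) := by
  have hm : 3 ≤ (facetAngles X c (ne_zero_of_mem_facetNormals hX1 hc)).card := by
    rw [card_facetAngles hX1]; exact three_le_card_tightSet hc
  rw [facetAngleAt_eq_polyDih hX1 h0 hc (by omega), polyDih_last_eq hm, angle_comm]

end VertexFanAngles

end Literature.Geometry.DiscreteGeometry

end
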